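import Summits.CriticalPhenomena.PercolationContinuityZ3.Theorems.PercNearOneGluingNoHeavyQuantFarGate3CertNSound
import HarnessLib

/-!
# QUANT lane R8, front "FAR beyond trees", layer one — THE DEGREE-THREE GATE AT THE OBSERVER, LXVIII: generic box-certificate engine over kernel N — COVERING
# (k-d trees of certificates over rational boxes in the chart variables `(y,a,b,c)`; `CertN.tree_sound`, `CertN.BoxOK`, `CertN.BoxOKR`)

builds on p205010 (kernel theorem, internal audit signed; external expert review pending)

Support file (`--supports stmt-CriticalPhenomena-4575`), seat `prim-quant-p1` (gen 35); memo
`run/shared/lean/prim/quant/prim-quant-p1-g35/FOR-LEAD-GATE3-PINCH.md`.  Files LXIII–LXVII only; standard axioms; no sorries.  Pattern of file LI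
(`ChartC` cover) with the chart as a parameter `S : CertN.Spec`.

A data file for chart `S` states `CertN.covers S fuel tree B = true` (by `decide +kernel`) for a rational box `B` and gets `CertN.BoxOK S B`: the chart
system `CertN.Bad S` has no bad point at any real point of `B`.  The per-chart link files turn `BoxOK` for the chart's tables into the chart-C / 8-cell
statement `hred8` on the image region.
[this work].
-/

namespace Summit.CriticalPhenomena.PercolationContinuityZ3.Theorems

namespace Quant

namespace CertN

/-- A rational box `[ylo, yhi] × [alo, ahi] × [blo, bhi] × [clo, chi]` in the chart variables `(y, a, b, c)`. -/
structure QBox where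
  ylo : ℚ
  yhi : ℚ
  alo : ℚ
  ahi : ℚ
  blo : ℚ
  bhi : ℚ
  clo : ℚ
  chi : ℚ

/-- Replace the upper (`upper = true`) or lower end of axis `ax` (0 = `y`, 1 = `a`, 2 = `b`, 3 = `c`) by `t`. -/
def QBox.cut (B : QBox) (ax : ℕ) (t : ℚ) (upper : Bool) : QBox :=
  match ax, upper with
  | 0, true => { B with yhi := t }
  | 0, false => { B with ylo := t }
  | 1, true => { B with ahi := t }
  | 1, false => { B with alo := t }
  | 2, true => { B with bhi := t }
  | 2, false => { B with blo := t }
  | _, true => { B with chi := t }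
  | _, false => { B with clo := t }

/-- k-d tree of certificates. -/
inductive Tree where
  | leaf (d : Cert) : Tree
  | node (ax : ℕ) (t : ℚ) (tlo thi : Tree) : Tree

/-- The certificate's integer box contains the rational box `B`. -/
def certContains (d : Cert) (B : QBox) : Bool :=
  decide (0 < d.D) && decide ((d.Y0 : ℚ) ≤ d.D * B.ylo) && decide ((d.D : ℚ) * B.yhi ≤ d.Y1) &&
    decide ((d.A0 : ℚ) ≤ d.D * B.alo) && decide ((d.D : ℚ) * B.ahi ≤ d.A1) &&
    decide ((d.B0 : ℚ) ≤ d.D * B.blo) && decide ((d.D : ℚ) * B.bhi ≤ d.B1) &&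
    decide ((d.C0 : ℚ) ≤ d.D * B.clo) && decide ((d.D : ℚ) * B.chi ≤ d.C1)

/-- The tree `t` covers the box `B` with checked certificates of chart `S` (fuel recursion). -/
def covers (S : Spec) : ℕ → Tree → QBox → Bool
  | 0, _, _ => false
  | _ + 1, Tree.leaf d, B => check S d && certContains d B
  | fuel + 1, Tree.node ax t tlo thi, B => covers S fuel tlo (B.cut ax t true) && covers S fuel thi (B.cut ax t false)

/-- Chart `S` has no bad point at any real point of the rational box `B`. -/
def BoxOK (S : Spec) (B : QBox) : Prop := ∀ (y a b c : ℝ),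
    (B.ylo : ℝ) ≤ y → y ≤ B.yhi → (B.alo : ℝ) ≤ a → a ≤ B.ahi → (B.blo : ℝ) ≤ b → b ≤ B.bhi → (B.clo : ℝ) ≤ c → c ≤ B.chi →
    ∀ v : Fin 8 → ℝ, ¬ Bad S y a b c v

/-- The same with the eight bounds as real parameters (the shape used by the dispatch theorems of the data files). -/
def BoxOKR (S : Spec) (ylo yhi alo ahi blo bhi clo chi : ℝ) : Prop := ∀ (y a b c : ℝ),
    ylo ≤ y → y ≤ yhi → alo ≤ a → a ≤ ahi → blo ≤ b → b ≤ bhi → clo ≤ c → c ≤ chi → ∀ v : Fin 8 → ℝ, ¬ Bad S y a b c v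

set_option maxHeartbeats 800000 in
/-- A checked certificate containing the box refutes the chart system on it. [this work] -/
theorem cert_apply (S : Spec) (hS : specOk S = true) (d : Cert) (B : QBox) (hchk : check S d = true) (hcont : certContains d B = true) :
    BoxOK S B := by
  intro y a b c hylo hyhi halo hahi hblo hbhi hclo hchi v
  simp only [certContains, Bool.and_eq_true, decide_eq_true_eq] at hcont
  obtain ⟨⟨⟨⟨⟨⟨⟨⟨hD, hY0⟩, hY1⟩, hA0⟩, hA1⟩, hB0⟩, hB1⟩, hC0⟩, hC1⟩ := hcont
  have hDpos : (0 : ℝ) < d.D := by exact_mod_cast hD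
  have hD0 := hDpos.le
  have hY0' : ((d.Y0 : ℚ) : ℝ) ≤ ((d.D : ℚ) : ℝ) * (B.ylo : ℝ) := by exact_mod_cast hY0
  have hY1' : ((d.D : ℚ) : ℝ) * (B.yhi : ℝ) ≤ ((d.Y1 : ℚ) : ℝ) := by exact_mod_cast hY1
  have hA0' : ((d.A0 : ℚ) : ℝ) ≤ ((d.D : ℚ) : ℝ) * (B.alo : ℝ) := by exact_mod_cast hA0
  have hA1' : ((d.D : ℚ) : ℝ) * (B.ahi : ℝ) ≤ ((d.A1 : ℚ) : ℝ) := by exact_mod_cast hA1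
  have hB0' : ((d.B0 : ℚ) : ℝ) ≤ ((d.D : ℚ) : ℝ) * (B.blo : ℝ) := by exact_mod_cast hB0
  have hB1' : ((d.D : ℚ) : ℝ) * (B.bhi : ℝ) ≤ ((d.B1 : ℚ) : ℝ) := by exact_mod_cast hB1
  have hC0' : ((d.C0 : ℚ) : ℝ) ≤ ((d.D : ℚ) : ℝ) * (B.clo : ℝ) := by exact_mod_cast hC0
  have hC1' : ((d.D : ℚ) : ℝ) * (B.chi : ℝ) ≤ ((d.C1 : ℚ) : ℝ) := by exact_mod_cast hC1
  simp only [Rat.cast_natCast, Rat.cast_intCast] at hY0' hY1' hA0' hA1' hB0' hB1' hC0' hC1'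
  exact sound y a b c d S hS hchk
    (hY0'.trans (mul_le_mul_of_nonneg_left hylo hD0)) (le_trans (mul_le_mul_of_nonneg_left hyhi hD0) hY1')
    (hA0'.trans (mul_le_mul_of_nonneg_left halo hD0)) (le_trans (mul_le_mul_of_nonneg_left hahi hD0) hA1')
    (hB0'.trans (mul_le_mul_of_nonneg_left hblo hD0)) (le_trans (mul_le_mul_of_nonneg_left hbhi hD0) hB1')
    (hC0'.trans (mul_le_mul_of_nonneg_left hclo hD0)) (le_trans (mul_le_mul_of_nonneg_left hchi hD0) hC1') v

/-- **Coverage theorem.** A covered box has no bad point. [this work] -/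
theorem tree_sound (S : Spec) (hS : specOk S = true) : ∀ (fuel : ℕ) (t : Tree) (B : QBox), covers S fuel t B = true → BoxOK S B
  | 0, t, B, hcov => by simp [covers] at hcov
  | fuel + 1, Tree.leaf d, B, hcov => by
    simp only [covers, Bool.and_eq_true] at hcov
    exact cert_apply S hS d B hcov.1 hcov.2
  | fuel + 1, Tree.node ax t tlo thi, B, hcov => by
    intro y a b c hylo hyhi halo hahi hblo hbhi hclo hchi v
    simp only [covers, Bool.and_eq_true] at hcov
    obtain ⟨hclo', hchi'⟩ := hcov
    have ihlo := tree_sound S hS fuel tlo (B.cut ax t true) hclo' y a b c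
    have ihhi := tree_sound S hS fuel thi (B.cut ax t false) hchi' y a b c
    rcases Nat.lt_or_ge ax 1 with hax | hax
    · have hax0 : ax = 0 := by omega
      subst hax0
      rcases le_total y (t : ℝ) with hle | hge
      · exact ihlo (by simpa [QBox.cut] using hylo) (by simpa [QBox.cut] using hle) (by simpa [QBox.cut] using halo) (by simpa [QBox.cut] using hahi) (by simpa [QBox.cut] using hblo) (by simpa [QBox.cut] using hbhi) (by simpa [QBox.cut] using hclo) (by simpa [QBox.cut] using hchi) v
      · exact ihhi (by simpa [QBox.cut] using hge) (by simpa [QBox.cut] using hyhi) (by simpa [QBox.cut] using halo) (by simpa [QBox.cut] using hahi) (by simpa [QBox.cut] using hblo) (by simpa [QBox.cut] using hbhi) (by simpa [QBox.cut] using hclo) (by simpa [QBox.cut] using hchi) v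
    · rcases Nat.lt_or_ge ax 2 with hax1 | hax2
      · have hax1' : ax = 1 := by omega
        subst hax1'
        rcases le_total a (t : ℝ) with hle | hge
        · exact ihlo (by simpa [QBox.cut] using hylo) (by simpa [QBox.cut] using hyhi) (by simpa [QBox.cut] using halo) (by simpa [QBox.cut] using hle) (by simpa [QBox.cut] using hblo) (by simpa [QBox.cut] using hbhi) (by simpa [QBox.cut] using hclo) (by simpa [QBox.cut] using hchi) v
        · exact ihhi (by simpa [QBox.cut] using hylo) (by simpa [QBox.cut] using hyhi) (by simpa [QBox.cut] using hge) (by simpa [QBox.cut] using hahi) (by simpa [QBox.cut] using hblo) (by simpa [QBox.cut] using hbhi) (by simpa [QBox.cut] using hclo) (by simpa [QBox.cut] using hchi) v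
      · rcases Nat.lt_or_ge ax 3 with hax2' | hax3
        · have hax2'' : ax = 2 := by omega
          subst hax2''
          rcases le_total b (t : ℝ) with hle | hge
          · exact ihlo (by simpa [QBox.cut] using hylo) (by simpa [QBox.cut] using hyhi) (by simpa [QBox.cut] using halo) (by simpa [QBox.cut] using hahi) (by simpa [QBox.cut] using hblo) (by simpa [QBox.cut] using hle) (by simpa [QBox.cut] using hclo) (by simpa [QBox.cut] using hchi) v
          · exact ihhi (by simpa [QBox.cut] using hylo) (by simpa [QBox.cut] using hyhi) (by simpa [QBox.cut] using halo) (by simpa [QBox.cut] using hahi) (by simpa [QBox.cut] using hge) (by simpa [QBox.cut] using hbhi) (by simpa [QBox.cut] using hclo) (by simpa [QBox.cut] using hchi) v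
        · obtain ⟨m, hm⟩ : ∃ m, ax = m + 3 := ⟨ax - 3, by omega⟩
          subst hm
          rcases le_total c (t : ℝ) with hle | hge
          · exact ihlo (by simpa [QBox.cut] using hylo) (by simpa [QBox.cut] using hyhi) (by simpa [QBox.cut] using halo) (by simpa [QBox.cut] using hahi) (by simpa [QBox.cut] using hblo) (by simpa [QBox.cut] using hbhi) (by simpa [QBox.cut] using hclo) (by simpa [QBox.cut] using hle) v
          · exact ihhi (by simpa [QBox.cut] using hylo) (by simpa [QBox.cut] using hyhi) (by simpa [QBox.cut] using halo) (by simpa [QBox.cut] using hahi) (by simpa [QBox.cut] using hblo) (by simpa [QBox.cut] using hbhi) (by simpa [QBox.cut] using hge) (by simpa [QBox.cut] using hchi) v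

/-- A covered box satisfies `BoxOK`. [this work] -/
theorem boxOK_of_covers (S : Spec) (hS : specOk S = true) (fuel : ℕ) (t : Tree) (B : QBox) (h : covers S fuel t B = true) : BoxOK S B :=
  tree_sound S hS fuel t B h

/-- `BoxOK S B` is `BoxOKR` of the cast bounds. [this work] -/
theorem boxOKR_of_boxOK (S : Spec) (B : QBox) (h : BoxOK S B) : BoxOKR S B.ylo B.yhi B.alo B.ahi B.blo B.bhi B.clo B.chi :=
  h

/-- Monotonicity of `BoxOKR` in the box (sub-boxes inherit). [this work] -/
theorem boxOKR_mono (S : Spec) {ylo yhi alo ahi blo bhi clo chi ylo' yhi' alo' ahi' blo' bhi' clo' chi' : ℝ}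
    (h : BoxOKR S ylo yhi alo ahi blo bhi clo chi) (hy0 : ylo ≤ ylo') (hy1 : yhi' ≤ yhi) (ha0 : alo ≤ alo') (ha1 : ahi' ≤ ahi)
    (hb0 : blo ≤ blo') (hb1 : bhi' ≤ bhi) (hc0 : clo ≤ clo') (hc1 : chi' ≤ chi) : BoxOKR S ylo' yhi' alo' ahi' blo' bhi' clo' chi' :=
  fun y a b c h1 h2 h3 h4 h5 h6 h7 h8 v => h y a b c (by linarith) (by linarith) (by linarith) (by linarith) (by linarith) (by linarith)
    (by linarith) (by linarith) v

end CertN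

end Quant

end Summit.CriticalPhenomena.PercolationContinuityZ3.Theorems
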